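import Literature.Probability.Percolation.TwoClusterConditionalAssociationProofs
import Summits.CriticalPhenomena.PercolationContinuityZ3.Theorems.PercNearOneGluingNoHeavyLowerTailCoreAttractionSep
import Summits.CriticalPhenomena.PercolationContinuityZ3.Theorems.PercNearOneGluingAdditiveGluingPocketBHKCov
import HarnessLib

/-!
# LEMMA 1 of THEOREM E — separating the other marked points makes membership in one cluster likelier (lane prim-rate, constants-miner 1, gen 16; CANDIDATES §GEN-16 R128, BENCH l.177 M1-ISO5)

Support file for the closed crux `NoHeavyLowerTail` (stmt-CriticalPhenomena-4575), majority-gluing line, rows M1-SEP5 (l.137) /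
M1-ISO5 (l.177).  THEOREM E of the lane (`prim-rate-mine-1/K1-PROOF.md`): `μ(⊥)^5 ≤ ∏_t μ(Iso_t)^2` for every finite weighted graph
and every five marked points.  Its ONE probabilistic input is

**LEMMA 1.**  For Bernoulli bond percolation with arbitrary edge probabilities on a finite vertex set, a vertex `s`, a finite set `X` of
other vertices and any vertex `v`:  `P(v ∈ C_s | s ↮ X and the points of X pairwise separated) ≥ P(v ∈ C_s | s ↮ X)`, i.e.
(denominator-free) `μ(Iso ∩ Sep)·μ(Iso ∩ {s ↔ v}) ≤ μ(Iso)·μ(Iso ∩ Sep ∩ {s ↔ v})` with `Iso = {s ↮ X}`, `Sep = {X pairwise separated}`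
(`sep_clusterMono` below).

It is van den Berg–Häggström–Kahn (2006) Thm 1.3 — «the open cluster of `s` is conditionally positively associated given
`{s ↮ X}`», KERNEL-PROVED in the tree as `Literature.Probability.Percolation.BHK2006_clusterConditionalPositiveAssociation_holds` —
applied to the two increasing functions of `C_s`:  `G(C_s) = 1[v ∈ V(C_s)]` and `F(C_s) = P(Sep in the graph with V(C_s) deleted)`,
together with the domain Markov identity `E[1_Sep | C_s] = F(C_s)` on `Iso` (`sum_cond_sep`, the analogue for the event `Sep` of
`BHK2006.sum_cond_cluster`, proved the same way from `BHK2006.blockFubini`).  Everything is in the finite-sum language of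
`ConditionalPositiveAssociationProofs.lean` / `TwoClusterConditionalAssociationProofs.lean` (mine-2's files), converted back to
`(prodBernoulli w).real` at the end (`PocketBHK.real_eq_sum_weight_ind`, `CoreAttractionSep.setIntegral_eq_sum_ind`).  No definitions, no sorries, no named-fact hypotheses.
[cite: VandenbergHaggstromKahn2005, Thm. 1.3 (p. 6)]
-/

noncomputable section

namespace Summit.CriticalPhenomena.PercolationContinuityZ3.Theorems

namespace HubOnly
namespace Refresh
namespace IsoFive

open MeasureTheory
open Literature.Probability.LatticeModels (prodBernoulli)
open Literature.Probability.Percolation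
open Literature.Probability.Percolation.BHK2006
open DecisionTree (ind ind_of_mem ind_of_not_mem ind_nonneg)
open scoped Classical

section Graph

variable {V : Type*}

/-- Deleting the pairs of `B` twice is deleting them once. [folklore] -/
theorem sdiff_sdiff_self (η B : Set (Sym2 V)) : (η \ B) \ B = η \ B := by
  rw [Set.sdiff_sdiff, Set.union_self]

/-- **Separation off the cluster of `s`.**  On `{C_s = W}`, if no point of `X` lies in `{s} ∪ V(W)`, then the points of `X` are
pairwise separated in `ω` iff they are pairwise separated in the configuration with the pairs of `W̄` deleted (their clusters
live in the graph with `V(C_s)` removed: `BHK2006.openEdgeCluster_eq_sdiff_bar`). [cite: VandenbergHaggstromKahn2005, §1 p. 8] -/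
theorem sep_iff_sep_sdiff_bar {s : V} {W ω : Set (Sym2 V)} (hW : openEdgeCluster ω s = W) {X : Set V}
    (hX : ∀ x ∈ X, ¬ (x = s ∨ ∃ e ∈ W, x ∈ e)) :
    (∀ x ∈ X, ∀ x' ∈ X, x ≠ x' → ¬ (openGraph ω).Reachable x x') ↔
      (∀ x ∈ X, ∀ x' ∈ X, x ≠ x' →
        ¬ (openGraph (ω \ {e | ∃ u ∈ e, u = s ∨ ∃ e' ∈ W, u ∈ e'})).Reachable x x') := by
  constructor
  · intro h x hx x' hx' hne hr
    exact h x hx x' hx' hne (hr.mono (openGraph_le Set.sdiff_subset))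
  · intro h x hx x' hx' hne hr
    apply h x hx x' hx' hne
    rw [reachable_iff_exists_mem_openEdgeCluster] at hr ⊢
    rwa [← openEdgeCluster_eq_sdiff_bar hW (hX x hx)]

end Graph

section Sums

variable {V : Type*} [Fintype V]

/-- The conditional separation probability `φ(W) = Σ_η weight(η)·1[X pairwise separated in η ∖ W̄]` is INCREASING in `W`:
deleting more pairs can only help a disconnection event. [folklore] -/
theorem condSep_mono {w : Sym2 V → ℝ} (hw0 : ∀ e, 0 ≤ w e) (hw1 : ∀ e, w e ≤ 1) (s : V) (X : Set V) :
    Monotone fun W : Set (Sym2 V) => ∑ η, weight w η *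
      ind {ζ : Set (Sym2 V) | ∀ x ∈ X, ∀ x' ∈ X, x ≠ x' → ¬ (openGraph ζ).Reachable x x'}
        (η \ {e | ∃ u ∈ e, u = s ∨ ∃ e' ∈ W, u ∈ e'}) := by
  intro W W' hWW'
  refine Finset.sum_le_sum fun η _ => mul_le_mul_of_nonneg_left ?_ (weight_nonneg hw0 hw1 η)
  have hsub : η \ {e | ∃ u ∈ e, u = s ∨ ∃ e' ∈ W', u ∈ e'} ⊆ η \ {e | ∃ u ∈ e, u = s ∨ ∃ e' ∈ W, u ∈ e'} :=
    Set.sdiff_subset_sdiff_right (bar_mono s hWW')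
  by_cases hsep : (η \ {e | ∃ u ∈ e, u = s ∨ ∃ e' ∈ W, u ∈ e'}) ∈
      {ζ : Set (Sym2 V) | ∀ x ∈ X, ∀ x' ∈ X, x ≠ x' → ¬ (openGraph ζ).Reachable x x'}
  · have hsep' : (η \ {e | ∃ u ∈ e, u = s ∨ ∃ e' ∈ W', u ∈ e'}) ∈
        {ζ : Set (Sym2 V) | ∀ x ∈ X, ∀ x' ∈ X, x ≠ x' → ¬ (openGraph ζ).Reachable x x'} :=
      fun x hx x' hx' hne hr => hsep x hx x' hx' hne (hr.mono (openGraph_le hsub))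
    rw [ind_of_mem hsep, ind_of_mem hsep']
  · rw [ind_of_not_mem hsep]
    exact ind_nonneg _ _

/-- **The domain Markov identity for the separation of the other points** (the analogue of `BHK2006.sum_cond_cluster`):
for any function `H` of the cluster of `s`,
`E[H(C_s)·1_Sep·1_Iso] = E[H(C_s)·φ(C_s)·1_Iso]`, `Iso = {s ↮ X}`, `Sep = {X pairwise separated}`,
`φ(W) = Σ_η weight(η)·1_Sep(η ∖ W̄)` — given `C_s = W` (with `X` off `{s} ∪ V(W)`), `Sep` is the separation event of the fresh
configuration off `W̄`. [cite: VandenbergHaggstromKahn2005, §1 pp. 7–8 (display (10) and the paragraph following it)] -/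
theorem sum_cond_sep (w : Sym2 V → ℝ) (hm : ∑ ω, weight w ω = 1) (s : V) (X : Set V)
    (H : Set (Sym2 V) → ℝ) :
    ∑ ω, weight w ω * (H (openEdgeCluster ω s) *
        ind {ζ : Set (Sym2 V) | ∀ x ∈ X, ∀ x' ∈ X, x ≠ x' → ¬ (openGraph ζ).Reachable x x'} ω *
        ind {ζ : Set (Sym2 V) | ∀ x ∈ X, ¬ (openGraph ζ).Reachable s x} ω) =
      ∑ ω, weight w ω * (H (openEdgeCluster ω s) *
        (∑ η, weight w η *
          ind {ζ : Set (Sym2 V) | ∀ x ∈ X, ∀ x' ∈ X, x ≠ x' → ¬ (openGraph ζ).Reachable x x'}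
            (η \ {e | ∃ u ∈ e, u = s ∨ ∃ e' ∈ openEdgeCluster ω s, u ∈ e'})) *
        ind {ζ : Set (Sym2 V) | ∀ x ∈ X, ¬ (openGraph ζ).Reachable s x} ω) := by
  set SEP : Set (Set (Sym2 V)) :=
    {ζ | ∀ x ∈ X, ∀ x' ∈ X, x ≠ x' → ¬ (openGraph ζ).Reachable x x'} with hSEP
  set D : Set (Set (Sym2 V)) := {ζ | ∀ x ∈ X, ¬ (openGraph ζ).Reachable s x} with hD
  -- the identity on each event `{C_s = W}`
  have key : ∀ W : Set (Sym2 V),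
      ∑ ω, (if openEdgeCluster ω s = W then
          weight w ω * (H W * ind SEP ω * ind D ω) else 0) =
      ∑ ω, (if openEdgeCluster ω s = W then
          weight w ω * (H W * (∑ η, weight w η *
            ind SEP (η \ {e | ∃ u ∈ e, u = s ∨ ∃ e' ∈ W, u ∈ e'})) * ind D ω) else 0) := by
    intro W
    by_cases hX : ∃ x ∈ X, (x = s ∨ ∃ e ∈ W, x ∈ e)
    · -- on `{C_s = W}`, some point of `X` is joined to `s`: both sides vanish termwise
      obtain ⟨x, hx, hxW⟩ := hX
      refine Finset.sum_congr rfl fun ω _ => ?_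
      split_ifs with hW
      · have hr : (openGraph ω).Reachable s x := by
          rw [reachable_iff_exists_mem_openEdgeCluster, hW]; exact hxW
        have hnD : ω ∉ D := fun h => h x hx hr
        simp only [ind_of_not_mem hnD, mul_zero]
      · rfl
    · have hX' : ∀ x ∈ X, ¬ (x = s ∨ ∃ e ∈ W, x ∈ e) := fun x hx h => hX ⟨x, hx, h⟩
      -- block Fubini with the block `A = W̄`
      set A : Set (Sym2 V) := {e | ∃ u ∈ e, u = s ∨ ∃ e' ∈ W, u ∈ e'} with hA
      set Φ : Set (Sym2 V) → Set (Sym2 V) → ℝ := fun ζ η =>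
        if openEdgeCluster ζ s = W then H W * ind SEP (η \ A) else 0 with hΦ
      have hind : ∀ ω, openEdgeCluster ω s = W → ind D ω = 1 := fun ω hW =>
        ind_of_mem (fun x hx hr => hX' x hx (by
          rw [reachable_iff_exists_mem_openEdgeCluster, hW] at hr; exact hr))
      have hsepA : ∀ ω, openEdgeCluster ω s = W → ind SEP ω = ind SEP (ω \ A) := by
        intro ω hW
        have hiff := sep_iff_sep_sdiff_bar (X := X) hW hX'
        by_cases h1 : ω ∈ SEP
        · rw [ind_of_mem h1, ind_of_mem (show ω \ A ∈ SEP from hiff.1 h1)]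
        · have h2 : ω \ A ∉ SEP := fun h => h1 (hiff.2 h)
          rw [ind_of_not_mem h1, ind_of_not_mem h2]
      have h1 : ∀ ω, (if openEdgeCluster ω s = W then
          weight w ω * (H W * ind SEP ω * ind D ω) else 0) =
          weight w ω * Φ (ω ∩ A) (ω \ A) := by
        intro ω
        simp only [hΦ, hA, openEdgeCluster_inter_bar_eq_iff, sdiff_sdiff_self]
        split_ifs with hW
        · rw [hind ω hW, mul_one, hsepA ω hW]
        · rw [mul_zero]
      have h2 : ∀ ω, weight w ω * ∑ ω', weight w ω' * Φ (ω ∩ A) (ω' \ A) =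
          (if openEdgeCluster ω s = W then
            weight w ω * (H W * (∑ η, weight w η * ind SEP (η \ A)) * ind D ω)
          else 0) := by
        intro ω
        simp only [hΦ, hA, openEdgeCluster_inter_bar_eq_iff, sdiff_sdiff_self]
        split_ifs with hW
        · rw [hind ω hW, mul_one]
          congr 1
          rw [Finset.mul_sum]
          exact Finset.sum_congr rfl fun η _ => by ring
        · simp
      calc ∑ ω, (if openEdgeCluster ω s = W then
              weight w ω * (H W * ind SEP ω * ind D ω) else 0)
          = (∑ ω, weight w ω) * ∑ ω, weight w ω * Φ (ω ∩ A) (ω \ A) := by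
            rw [hm, one_mul]; exact Finset.sum_congr rfl fun ω _ => h1 ω
        _ = ∑ ω, weight w ω * ∑ ω', weight w ω' * Φ (ω ∩ A) (ω' \ A) := blockFubini w A Φ
        _ = _ := Finset.sum_congr rfl fun ω _ => h2 ω
  -- sum over `W`
  calc ∑ ω, weight w ω * (H (openEdgeCluster ω s) * ind SEP ω * ind D ω)
      = ∑ ω, ∑ W, (if openEdgeCluster ω s = W then
          weight w ω * (H W * ind SEP ω * ind D ω) else 0) :=
        Finset.sum_congr rfl fun ω _ => (Fintype.sum_ite_eq (openEdgeCluster ω s)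
          fun W => weight w ω * (H W * ind SEP ω * ind D ω)).symm
    _ = ∑ W, ∑ ω, (if openEdgeCluster ω s = W then
          weight w ω * (H W * ind SEP ω * ind D ω) else 0) := Finset.sum_comm
    _ = ∑ W, ∑ ω, (if openEdgeCluster ω s = W then
          weight w ω * (H W * (∑ η, weight w η *
            ind SEP (η \ {e | ∃ u ∈ e, u = s ∨ ∃ e' ∈ W, u ∈ e'})) * ind D ω) else 0) :=
        Finset.sum_congr rfl fun W _ => key W
    _ = ∑ ω, ∑ W, (if openEdgeCluster ω s = W then
          weight w ω * (H W * (∑ η, weight w η *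
            ind SEP (η \ {e | ∃ u ∈ e, u = s ∨ ∃ e' ∈ W, u ∈ e'})) * ind D ω) else 0) :=
        Finset.sum_comm
    _ = _ :=
        Finset.sum_congr rfl fun ω _ => Fintype.sum_ite_eq (openEdgeCluster ω s)
          fun W => weight w ω * (H W * (∑ η, weight w η *
            ind SEP (η \ {e | ∃ u ∈ e, u = s ∨ ∃ e' ∈ W, u ∈ e'})) * ind D ω)

end Sums

/-! ### LEMMA 1 -/

section Main

variable {V : Type} [Fintype V]

/-- **LEMMA 1 of THEOREM E (K1-PROOF.md §2; CANDIDATES §GEN-16 R128).**  For every finite weighted graph (`prodBernoulli w` on the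
pairs of a finite vertex type), every vertex `s`, every finite set `X ∌ s` of other marked points and every vertex `v`:
conditioning the points of `X` to be pairwise separated, on top of `{s ↮ X}`, can only make `{s ↔ v}` likelier —
`μ({s ↮ X} ∩ Sep_X) · μ({s ↮ X} ∩ {s ↔ v}) ≤ μ({s ↮ X}) · μ({s ↮ X} ∩ Sep_X ∩ {s ↔ v})`.
With `|X| = 4` this is `P(v ∈ C_{t_i} | ⊥) ≥ P(v ∈ C_{t_i} | Iso_{t_i})`, the only probabilistic input of the proof of (ISO5).
Proof: vdBHK Thm 1.3 (`BHK2006_clusterConditionalPositiveAssociation_holds`) with `F(C_s) = φ(C_s)` (`condSep_mono`) and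
`G(C_s) = 1[v ∈ V(C_s)]`, plus `sum_cond_sep`. [cite: VandenbergHaggstromKahn2005, Thm. 1.3 (p. 6)] -/
theorem sep_clusterMono (w : Sym2 V → unitInterval) (s v : V) (X : Finset V) (hs : s ∉ X) :
    (prodBernoulli w).real {ω : BondConfig V | (∀ x ∈ X, ¬ (openGraph ω).Reachable s x) ∧
        ∀ x ∈ X, ∀ x' ∈ X, x ≠ x' → ¬ (openGraph ω).Reachable x x'} *
      (prodBernoulli w).real {ω : BondConfig V | (∀ x ∈ X, ¬ (openGraph ω).Reachable s x) ∧
        (openGraph ω).Reachable s v} ≤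
    (prodBernoulli w).real {ω : BondConfig V | ∀ x ∈ X, ¬ (openGraph ω).Reachable s x} *
      (prodBernoulli w).real {ω : BondConfig V | (∀ x ∈ X, ¬ (openGraph ω).Reachable s x) ∧
        (∀ x ∈ X, ∀ x' ∈ X, x ≠ x' → ¬ (openGraph ω).Reachable x x') ∧ (openGraph ω).Reachable s v} := by
  set w' : Sym2 V → ℝ := fun e => (w e : ℝ) with hw'
  have hw0 : ∀ e, 0 ≤ w' e := fun e => (w e).2.1
  have hw1 : ∀ e, w' e ≤ 1 := fun e => (w e).2.2
  have hm : ∑ ω, weight w' ω = 1 := by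
    have h1 := integral_prodBernoulli_eq_sum w fun _ => (1 : ℝ)
    simp only [integral_const, probReal_univ, smul_eq_mul, mul_one] at h1
    exact h1.symm
  set SEP : Set (Set (Sym2 V)) :=
    {ζ | ∀ x ∈ (X : Set V), ∀ x' ∈ (X : Set V), x ≠ x' → ¬ (openGraph ζ).Reachable x x'} with hSEP
  set D : Set (BondConfig V) := {ζ | ∀ x ∈ (X : Set V), ¬ (openGraph ζ).Reachable s x} with hD
  set R : Set (Set (Sym2 V)) := {ζ | (openGraph ζ).Reachable s v} with hR
  -- the two increasing functions of `C_s`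
  set F : Set (Sym2 V) → ℝ := fun W => ∑ η, weight w' η *
    ind SEP (η \ {e | ∃ u ∈ e, u = s ∨ ∃ e' ∈ W, u ∈ e'}) with hF
  set G : Set (Sym2 V) → ℝ := fun W => ind {W' : Set (Sym2 V) | v = s ∨ ∃ e ∈ W', v ∈ e} W with hG
  have hFm : Monotone F := condSep_mono hw0 hw1 s (X : Set V)
  have hGm : Monotone G := by
    intro W W' hWW'
    simp only [hG]
    by_cases hW : W ∈ {W'' : Set (Sym2 V) | v = s ∨ ∃ e ∈ W'', v ∈ e}
    · have hW' : W' ∈ {W'' : Set (Sym2 V) | v = s ∨ ∃ e ∈ W'', v ∈ e} :=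
        hW.imp id fun ⟨e, he, hve⟩ => ⟨e, hWW' he, hve⟩
      rw [ind_of_mem hW, ind_of_mem hW']
    · rw [ind_of_not_mem hW]; exact ind_nonneg _ _
  -- `G(C_s ω) = 1[s ↔ v]`
  have hGR : ∀ ω : Set (Sym2 V), G (openEdgeCluster ω s) = ind R ω := by
    intro ω
    by_cases hr : (openGraph ω).Reachable s v
    · have : openEdgeCluster ω s ∈ {W' : Set (Sym2 V) | v = s ∨ ∃ e ∈ W', v ∈ e} :=
        (reachable_iff_exists_mem_openEdgeCluster ω s v).1 hr
      rw [hG]; simp only; rw [ind_of_mem this, ind_of_mem (show ω ∈ R from hr)]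
    · have : openEdgeCluster ω s ∉ {W' : Set (Sym2 V) | v = s ∨ ∃ e ∈ W', v ∈ e} :=
        fun h => hr ((reachable_iff_exists_mem_openEdgeCluster ω s v).2 h)
      rw [hG]; simp only; rw [ind_of_not_mem this, ind_of_not_mem (show ω ∉ R from hr)]
  -- vdBHK Theorem 1.3
  have hsX : s ∉ (X : Set V) := fun h => hs (Finset.mem_coe.1 h)
  have key := BHK2006_clusterConditionalPositiveAssociation_holds V w s (X : Set V) F G hFm hGm hsX
  -- the four integrals as sums
  have hD' : {ω : BondConfig V | ∀ x ∈ (X : Set V), ¬ (openGraph ω).Reachable s x} = D := rfl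
  rw [hD'] at key
  rw [CoreAttractionSep.setIntegral_eq_sum_ind w D (fun ω => F (openEdgeCluster ω s)),
    CoreAttractionSep.setIntegral_eq_sum_ind w D (fun ω => G (openEdgeCluster ω s)),
    CoreAttractionSep.setIntegral_eq_sum_ind w D (fun ω => F (openEdgeCluster ω s) * G (openEdgeCluster ω s))] at key
  -- identify them with the four probabilities
  have e1 : ∑ ω, weight w' ω * (F (openEdgeCluster ω s) * ind D ω) =
      ∑ ω, weight w' ω * ind (D ∩ SEP) ω := by
    have := sum_cond_sep w' hm s (X : Set V) (fun _ => (1 : ℝ))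
    simp only [one_mul] at this
    rw [← hSEP, ← hD] at this
    rw [show (∑ ω, weight w' ω * (F (openEdgeCluster ω s) * ind D ω)) =
        ∑ ω, weight w' ω * ((∑ η, weight w' η *
          ind SEP (η \ {e | ∃ u ∈ e, u = s ∨ ∃ e' ∈ openEdgeCluster ω s, u ∈ e'})) * ind D ω) from rfl,
      ← this]
    refine Finset.sum_congr rfl fun ω _ => ?_
    rw [ind_inter, mul_comm (ind D ω)]
  have e2 : ∑ ω, weight w' ω * (G (openEdgeCluster ω s) * ind D ω) =
      ∑ ω, weight w' ω * ind (D ∩ R) ω := by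
    refine Finset.sum_congr rfl fun ω _ => ?_
    rw [hGR, ind_inter, mul_comm (ind D ω)]
  have e3 : ∑ ω, weight w' ω * (F (openEdgeCluster ω s) * G (openEdgeCluster ω s) * ind D ω) =
      ∑ ω, weight w' ω * ind (D ∩ (SEP ∩ R)) ω := by
    have := sum_cond_sep w' hm s (X : Set V) G
    rw [← hSEP, ← hD] at this
    rw [show (∑ ω, weight w' ω * (F (openEdgeCluster ω s) * G (openEdgeCluster ω s) * ind D ω)) =
        ∑ ω, weight w' ω * (G (openEdgeCluster ω s) * (∑ η, weight w' η *
          ind SEP (η \ {e | ∃ u ∈ e, u = s ∨ ∃ e' ∈ openEdgeCluster ω s, u ∈ e'})) * ind D ω) from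
        Finset.sum_congr rfl fun ω _ => by ring,
      ← this]
    refine Finset.sum_congr rfl fun ω _ => ?_
    rw [hGR, ind_inter, ind_inter]
    ring
  rw [e1, e2, e3, ← PocketBHK.real_eq_sum_weight_ind, ← PocketBHK.real_eq_sum_weight_ind,
    ← PocketBHK.real_eq_sum_weight_ind] at key
  -- the sets coincide
  have s1 : D ∩ SEP = {ω : BondConfig V | (∀ x ∈ X, ¬ (openGraph ω).Reachable s x) ∧
      ∀ x ∈ X, ∀ x' ∈ X, x ≠ x' → ¬ (openGraph ω).Reachable x x'} := by
    ext ω; simp only [hD, hSEP, Set.mem_inter_iff, Set.mem_setOf_eq, Finset.mem_coe]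
  have s2 : D ∩ R = {ω : BondConfig V | (∀ x ∈ X, ¬ (openGraph ω).Reachable s x) ∧
      (openGraph ω).Reachable s v} := by
    ext ω; simp only [hD, hR, Set.mem_inter_iff, Set.mem_setOf_eq, Finset.mem_coe]
  have s3 : D ∩ (SEP ∩ R) = {ω : BondConfig V | (∀ x ∈ X, ¬ (openGraph ω).Reachable s x) ∧
      (∀ x ∈ X, ∀ x' ∈ X, x ≠ x' → ¬ (openGraph ω).Reachable x x') ∧ (openGraph ω).Reachable s v} := by
    ext ω; simp only [hD, hSEP, hR, Set.mem_inter_iff, Set.mem_setOf_eq, Finset.mem_coe]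
  have s0 : D = {ω : BondConfig V | ∀ x ∈ X, ¬ (openGraph ω).Reachable s x} := by
    ext ω; simp only [hD, Set.mem_setOf_eq, Finset.mem_coe]
  rw [s1, s2, s3, s0] at key
  exact key

end Main

end IsoFive
end Refresh
end HubOnly
end Summit.CriticalPhenomena.PercolationContinuityZ3.Theorems
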